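import Summits.KontsevichZagierPeriods.KontsevichZagierPeriods.Theorems.SoloInformedSemialgebraicFibreLogic
import HarnessLib

/-!
# SoloInformed — validity of an equi-affine tame dissection is a `ℚ`-semialgebraic condition

Solo programme `solo-KontsevichZagierPeriods-informed`, session s138, file 2 of the kernel form of
COROLLARY SQ (VERDICT §4, `real-parameters.md`): **tame Tarski circle squaring is impossible**.
Session s137 put the real-algebraic ENGINE in the kernel (`soloInformed_realParameter_barrier_core`:
a `ℚ`-semialgebraic validity condition on real parameters all of whose solutions give one fixed
transcendental value to a rational polynomial has no solution) and left on PAPER the statement that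
the validity of a tame dissection of fixed shape IS such a condition.  This file discharges that
statement for EQUI-AFFINE dissections.

A SHAPE (`SoloInformedTameShape K n N`) over a finite real-parameter index `K` consists of `N`
`ℚ`-semialgebraic families `S i ⊆ ℝ^{K ⊕ n}` (whose fibres `{x | (p, x) ∈ S i}` are the pieces),
`N` matrices and `N` vectors of rational polynomials in the parameters (the moving maps
`x ↦ M_i(p) x + b_i(p)`), and `n` rational polynomials (the sides `a_j(p)` of the target box
`∏_j [0, a_j(p)]`).  A parameter `p : K → ℝ` is VALID for a source `D₀ ⊆ ℝⁿ`
(`SoloInformedTameShape.Valid`, spelled out by `SoloInformedTameShape.valid_iff`) when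
`det M_i(p)² = 1`, `a_j(p) ≥ 0`, the pieces partition `D₀` exactly, and their images partition the
box exactly — the image conditions being phrased through the POLYNOMIAL inverse maps
`y ↦ det M • adj M (y - b)` (`soloInformedAffInv`), so that every clause is a polynomial condition in
`(p, z)` preceded by one universal quantifier over the space variable `z`.

* `SoloInformedTameShape.isSemialgebraic_setOf_jointCond` — the joint condition in `(p, z)` is
  `ℚ`-semialgebraic (generators, preimages under polynomial maps, finite Boolean combinations);
* `SoloInformedTameShape.isSemialgebraic_setOf_valid` — **`{p | Valid p}` is `ℚ`-semialgebraic**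
  (one Tarski–Seidenberg projection: `soloInformed_isSemialgebraic_setOf_forall_fibre`).

Every `ℝ`-semialgebraic dissection with real matrices / vectors / sides is the value of such a
shape at a real parameter (file 4, via s137's `soloInformed_isSemialgebraic_real_iff_fibre`).

References: Bochnak–Coste–Roy (1998) §2.2; Basu–Pollack–Roy (2006) §2.5; Tarski (1925) (the circle
squaring problem); Dubins–Hirsch–Karush (1963) (scissor congruence).
-/

noncomputable section

namespace Summit.KontsevichZagierPeriods.KontsevichZagierPeriods.Theorems

open Set MvPolynomial Literature.ModelTheory.ExponentialFields Literature.NumberTheory.Transcendental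

/-- The closed box `∏_j [0, a_j] ⊆ ℝⁿ` with sides `a`. [folklore] -/
def soloInformedTameBox {n : ℕ} (a : Fin n → ℝ) : Set (Fin n → ℝ) :=
  Set.pi Set.univ fun j => Set.Icc 0 (a j)

/-- **Shape of a tame equi-affine dissection** with `N` pieces in `ℝⁿ`, over the real-parameter
index `K`: the `ℚ`-semialgebraic families of the pieces and the rational-polynomial read-outs of
the matrices, translation vectors and box sides. [cite: BochnakCosteRoy1998, §2.2] -/
structure SoloInformedTameShape (K : Type*) (n N : ℕ) where
  /-- the families `S i ⊆ ℝ^{K ⊕ n}` whose fibres over the parameter are the pieces -/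
  S : Fin N → Set (K ⊕ Fin n → ℝ)
  /-- the matrices of the moving maps, entries rational polynomials in the parameters -/
  PM : Fin N → Matrix (Fin n) (Fin n) (MvPolynomial K ℚ)
  /-- the translation vectors of the moving maps -/
  Pb : Fin N → Fin n → MvPolynomial K ℚ
  /-- the sides of the target box -/
  Pa : Fin n → MvPolynomial K ℚ

namespace SoloInformedTameShape

variable {K : Type*} {n N : ℕ} (σ : SoloInformedTameShape K n N)

/-- The `i`-th matrix at the parameter `p`. [folklore] -/
def mat (i : Fin N) (p : K → ℝ) : Matrix (Fin n) (Fin n) ℝ := (σ.PM i).map (aeval p)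

/-- The `i`-th translation vector at the parameter `p`. [folklore] -/
def shift (i : Fin N) (p : K → ℝ) : Fin n → ℝ := fun t => aeval p (σ.Pb i t)

/-- The box sides at the parameter `p`. [folklore] -/
def side (p : K → ℝ) : Fin n → ℝ := fun j => aeval p (σ.Pa j)

/-- The `i`-th piece at the parameter `p`: the fibre of `S i`. [folklore] -/
def piece (i : Fin N) (p : K → ℝ) : Set (Fin n → ℝ) := {x | Sum.elim p x ∈ σ.S i}

/-- The inverse of the `i`-th moving map `x ↦ M_i(p) x + b_i(p)` (valid when `det² = 1`), as the
polynomial formula `y ↦ det M • adj M (y - b)`. [folklore] -/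
def inv (i : Fin N) (p : K → ℝ) (y : Fin n → ℝ) : Fin n → ℝ :=
  soloInformedAffInv (σ.mat i p) (σ.shift i p) y

/-- The joint condition on `w = (p, z) ∈ ℝ^{K ⊕ n}`: determinants `±1`, sides `≥ 0`, `z ∈ D₀` iff
`z` lies in some piece, no `z` in two pieces, `z` in the box iff some inverse image of `z` lies in
the corresponding piece, no `z` with two such inverse images. [folklore] -/
def jointCond (D₀ : Set (Fin n → ℝ)) (w : K ⊕ Fin n → ℝ) : Prop :=
  (∀ i, (σ.mat i (w ∘ Sum.inl)).det ^ 2 = 1) ∧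
  (∀ j, 0 ≤ σ.side (w ∘ Sum.inl) j) ∧
  ((w ∘ Sum.inr ∈ D₀ ↔ ∃ i, w ∈ σ.S i) ∧
  (∀ i j, i ≠ j → w ∈ σ.S i → w ∉ σ.S j) ∧
  (w ∘ Sum.inr ∈ soloInformedTameBox (σ.side (w ∘ Sum.inl)) ↔
    ∃ i, Sum.elim (w ∘ Sum.inl) (σ.inv i (w ∘ Sum.inl) (w ∘ Sum.inr)) ∈ σ.S i) ∧
  (∀ i j, i ≠ j → Sum.elim (w ∘ Sum.inl) (σ.inv i (w ∘ Sum.inl) (w ∘ Sum.inr)) ∈ σ.S i →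
    Sum.elim (w ∘ Sum.inl) (σ.inv j (w ∘ Sum.inl) (w ∘ Sum.inr)) ∉ σ.S j))

/-- **Validity** of the parameter `p` for the source `D₀`: the joint condition at `(p, z)` for every
space point `z`. [folklore] -/
def Valid (D₀ : Set (Fin n → ℝ)) (p : K → ℝ) : Prop :=
  ∀ z : Fin n → ℝ, σ.jointCond D₀ (Sum.elim p z)

/-- **What validity says**: `det M_i(p)² = 1`, `a_j(p) ≥ 0`, the pieces partition `D₀` exactly, and
— through the inverse maps — the images of the pieces partition the box `∏_j [0, a_j(p)]` exactly.
[folklore] -/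
theorem valid_iff {D₀ : Set (Fin n → ℝ)} {p : K → ℝ} : σ.Valid D₀ p ↔
    (∀ i, (σ.mat i p).det ^ 2 = 1) ∧ (∀ j, 0 ≤ σ.side p j) ∧
    ∀ z : Fin n → ℝ,
      (z ∈ D₀ ↔ ∃ i, z ∈ σ.piece i p) ∧
      (∀ i j, i ≠ j → z ∈ σ.piece i p → z ∉ σ.piece j p) ∧
      (z ∈ soloInformedTameBox (σ.side p) ↔ ∃ i, σ.inv i p z ∈ σ.piece i p) ∧
      (∀ i j, i ≠ j → σ.inv i p z ∈ σ.piece i p → σ.inv j p z ∉ σ.piece j p) := by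
  simp only [Valid, jointCond, Sum.elim_comp_inl, Sum.elim_comp_inr, piece, mem_setOf_eq, forall_and,
    forall_const]

section Atoms

variable {D₀ : Set (Fin n → ℝ)}

/-- The determinant clause is a polynomial equation in the parameter block. [folklore] -/
theorem isSemialgebraic_setOf_det_sq (i : Fin N) :
    IsSemialgebraic ℚ {w : K ⊕ Fin n → ℝ | (σ.mat i (w ∘ Sum.inl)).det ^ 2 = 1} := by
  have hset : {w : K ⊕ Fin n → ℝ | (σ.mat i (w ∘ Sum.inl)).det ^ 2 = 1} =
      {w | aeval w ((rename Sum.inl (σ.PM i).det) ^ 2 - 1) = 0} := by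
    ext w
    have hcomp : (⇑(aeval w) ∘ ⇑(rename Sum.inl) : MvPolynomial K ℚ → ℝ) = ⇑(aeval (w ∘ Sum.inl)) :=
      funext fun P => soloInformed_aeval_rename_inl w P
    simp only [mem_setOf_eq, map_sub, map_pow, map_one, sub_eq_zero, AlgHom.map_det,
      AlgHom.mapMatrix_apply, Matrix.map_map, hcomp, mat]
  rw [hset]
  exact isSemialgebraic_setOf_eval_eq_zero _

/-- The side clause is a polynomial inequality in the parameter block. [folklore] -/
theorem isSemialgebraic_setOf_side_nonneg (j : Fin n) :
    IsSemialgebraic ℚ {w : K ⊕ Fin n → ℝ | 0 ≤ σ.side (w ∘ Sum.inl) j} := by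
  have hset : {w : K ⊕ Fin n → ℝ | 0 ≤ σ.side (w ∘ Sum.inl) j} =
      {w | 0 ≤ aeval w (rename Sum.inl (σ.Pa j))} := by
    ext w
    simp only [mem_setOf_eq, soloInformed_aeval_rename_inl, side]
  rw [hset]
  exact isSemialgebraic_setOf_eval_nonneg _

/-- The box clause is a finite conjunction of polynomial inequalities. [folklore] -/
theorem isSemialgebraic_setOf_mem_box :
    IsSemialgebraic ℚ {w : K ⊕ Fin n → ℝ | w ∘ Sum.inr ∈ soloInformedTameBox (σ.side (w ∘ Sum.inl))} := by
  have hset : {w : K ⊕ Fin n → ℝ | w ∘ Sum.inr ∈ soloInformedTameBox (σ.side (w ∘ Sum.inl))} =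
      {w | ∀ j, 0 ≤ aeval w (X (Sum.inr j) : MvPolynomial (K ⊕ Fin n) ℚ) ∧
        aeval w (X (Sum.inr j) : MvPolynomial (K ⊕ Fin n) ℚ) ≤ aeval w (rename Sum.inl (σ.Pa j))} := by
    ext w
    simp only [soloInformedTameBox, side, mem_setOf_eq, mem_univ_pi, mem_Icc, Function.comp_apply, aeval_X,
      soloInformed_aeval_rename_inl]
  rw [hset]
  exact soloInformed_isSemialgebraic_setOf_forall fun j =>
    soloInformed_isSemialgebraic_setOf_and (isSemialgebraic_setOf_eval_nonneg _)
      (isSemialgebraic_setOf_eval_le _ _)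

/-- The polynomial map `w = (p, z) ↦ (p, inv_i(p)(z))` as a family of rational polynomials.
[folklore] -/
def invPoly (i : Fin N) : K ⊕ Fin n → MvPolynomial (K ⊕ Fin n) ℚ :=
  Sum.elim (fun l => X (Sum.inl l))
    (soloInformedAffInv ((σ.PM i).map (rename Sum.inl)) (fun t => rename Sum.inl (σ.Pb i t))
      (fun t => X (Sum.inr t)))

/-- Evaluating `invPoly` at `w = (p, z)` gives `(p, inv_i(p)(z))`. [folklore] -/
theorem aeval_invPoly (i : Fin N) (w : K ⊕ Fin n → ℝ) :
    (fun t => aeval w (σ.invPoly i t)) =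
      Sum.elim (w ∘ Sum.inl) (σ.inv i (w ∘ Sum.inl) (w ∘ Sum.inr)) := by
  have hM : ((σ.PM i).map (rename Sum.inl)).map ⇑(aeval w) = σ.mat i (w ∘ Sum.inl) := by
    ext r s
    simp only [Matrix.map_apply, soloInformed_aeval_rename_inl, mat]
  have hb : ⇑(aeval w) ∘ (fun t => rename Sum.inl (σ.Pb i t)) = σ.shift i (w ∘ Sum.inl) := by
    funext t
    simp only [Function.comp_apply, soloInformed_aeval_rename_inl, shift]
  have hy : ⇑(aeval w) ∘ (fun t => (X (Sum.inr t) : MvPolynomial (K ⊕ Fin n) ℚ)) = w ∘ Sum.inr := by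
    funext t
    simp only [Function.comp_apply, aeval_X]
  have hmap := soloInformed_map_affInv
    ((aeval w : MvPolynomial (K ⊕ Fin n) ℚ →ₐ[ℚ] ℝ) : MvPolynomial (K ⊕ Fin n) ℚ →+* ℝ)
    ((σ.PM i).map (rename Sum.inl)) (fun t => rename Sum.inl (σ.Pb i t)) (fun t => X (Sum.inr t))
  simp only [RingHom.coe_coe] at hmap
  rw [hM, hb, hy] at hmap
  funext t
  cases t with
  | inl l => simp only [invPoly, Sum.elim_inl, aeval_X, Function.comp_apply]
  | inr s =>
    simp only [invPoly, Sum.elim_inr, inv]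
    exact congr_fun hmap s

/-- The inverse-image clause `(p, inv_i(p)(z)) ∈ S i` is the preimage of `S i` under a polynomial
map, hence `ℚ`-semialgebraic. [cite: BochnakCosteRoy1998, §2.2] -/
theorem isSemialgebraic_setOf_inv_mem {i : Fin N} (hS : IsSemialgebraic ℚ (σ.S i)) :
    IsSemialgebraic ℚ {w : K ⊕ Fin n → ℝ |
      Sum.elim (w ∘ Sum.inl) (σ.inv i (w ∘ Sum.inl) (w ∘ Sum.inr)) ∈ σ.S i} := by
  have hset : {w : K ⊕ Fin n → ℝ |
      Sum.elim (w ∘ Sum.inl) (σ.inv i (w ∘ Sum.inl) (w ∘ Sum.inr)) ∈ σ.S i} =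
      (fun x : K ⊕ Fin n → ℝ => fun t => aeval x (σ.invPoly i t)) ⁻¹' σ.S i := by
    ext w
    simp only [mem_setOf_eq, mem_preimage]
    rw [aeval_invPoly]
  rw [hset]
  exact hS.preimage_aeval _

/-- **The joint condition is `ℚ`-semialgebraic in `(p, z)`.** [cite: BochnakCosteRoy1998, §2.2] -/
theorem isSemialgebraic_setOf_jointCond (hS : ∀ i, IsSemialgebraic ℚ (σ.S i))
    (hD₀ : IsSemialgebraic ℚ D₀) :
    IsSemialgebraic ℚ {w : K ⊕ Fin n → ℝ | σ.jointCond D₀ w} := by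
  unfold jointCond
  refine soloInformed_isSemialgebraic_setOf_and
    (soloInformed_isSemialgebraic_setOf_forall fun i => σ.isSemialgebraic_setOf_det_sq i) ?_
  refine soloInformed_isSemialgebraic_setOf_and
    (soloInformed_isSemialgebraic_setOf_forall fun j => σ.isSemialgebraic_setOf_side_nonneg j) ?_
  refine soloInformed_isSemialgebraic_setOf_and
    (soloInformed_isSemialgebraic_setOf_iff (hD₀.preimage_comp Sum.inr)
      (soloInformed_isSemialgebraic_setOf_exists fun i => hS i)) ?_
  refine soloInformed_isSemialgebraic_setOf_and
    (soloInformed_isSemialgebraic_setOf_forall fun i => soloInformed_isSemialgebraic_setOf_forall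
      fun j => soloInformed_isSemialgebraic_setOf_imp (soloInformed_isSemialgebraic_setOf_const _)
        (soloInformed_isSemialgebraic_setOf_imp (hS i) (soloInformed_isSemialgebraic_setOf_not (hS j))))
    ?_
  refine soloInformed_isSemialgebraic_setOf_and
    (soloInformed_isSemialgebraic_setOf_iff σ.isSemialgebraic_setOf_mem_box
      (soloInformed_isSemialgebraic_setOf_exists fun i => σ.isSemialgebraic_setOf_inv_mem (hS i))) ?_
  exact soloInformed_isSemialgebraic_setOf_forall fun i => soloInformed_isSemialgebraic_setOf_forall
    fun j => soloInformed_isSemialgebraic_setOf_imp (soloInformed_isSemialgebraic_setOf_const _)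
      (soloInformed_isSemialgebraic_setOf_imp (σ.isSemialgebraic_setOf_inv_mem (hS i))
        (soloInformed_isSemialgebraic_setOf_not (σ.isSemialgebraic_setOf_inv_mem (hS j))))

end Atoms

/-- **THEOREM (validity is first-order over `ℚ`).** For a shape with `ℚ`-semialgebraic families and
a `ℚ`-semialgebraic source `D₀`, the set of valid real parameters is `ℚ`-semialgebraic — one
Tarski–Seidenberg projection applied to the complement of the joint condition.
[cite: BochnakCosteRoy1998, Prop. 2.2.4] -/
theorem isSemialgebraic_setOf_valid [Finite K] {D₀ : Set (Fin n → ℝ)}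
    (hS : ∀ i, IsSemialgebraic ℚ (σ.S i)) (hD₀ : IsSemialgebraic ℚ D₀) :
    IsSemialgebraic ℚ {p : K → ℝ | σ.Valid D₀ p} :=
  soloInformed_isSemialgebraic_setOf_forall_fibre (σ.isSemialgebraic_setOf_jointCond hS hD₀)
    fun _ _ => Iff.rfl

end SoloInformedTameShape

end Summit.KontsevichZagierPeriods.KontsevichZagierPeriods.Theorems
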